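import Summits.ValiantsHypothesis.ValiantsHypothesis.Theorems.TwoAdicLadderTwoIntegralNormalisationFibreCoordinates

/-!
# TwoAdicLadder — crux `TwoIntegralNormalisation` (stmt-ValiantsHypothesis-5947):
# ARITHMETIC SPECIALISATION, part 2 — a finitely generated `ℤ`-domain in which `2` is not a unit
# maps to the local ring `𝓞_(P')`, `P' ∋ 2`, of some number field

Support lemma (pure commutative algebra) for the calibration `TwoIntegralNormalisation ⟺
HalfElimGlobal` (file `…PrecisionUniform.lean`): the "constants" of a circuit over a product of
finite `2`-adic chain rings, reduced modulo a prime avoiding the powers of `2`, generate a finitely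
generated `ℤ`-algebra `B` which is a domain of characteristic `0` in which `2` is not a unit; this
file shows that every such `B` admits a ring homomorphism to `Localization.AtPrime P'` for some prime
`P' ∋ 2` of the ring of integers of some number field `K'` (`exists_ringHom_localizationAtPrime`).
Geometrically: an integral affine scheme of finite type over `ℤ` whose fibre at `2` is non-empty
has a point with values in a `2`-adically integral number ring, specialising into that fibre.

Proof (Noether coordinates of the fibre from part 1 + Zariski's Main Theorem + going down):
* with the coordinates `t` of `exists_noether_lift`, `Λ = ℤ[X₁,…,X_e] → B` is injective and
  `B ⧸ 2B` is module-finite over `Λ`;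
* choose a prime `𝔫 ∋ 2` of `B` over the origin `𝔪 = (2, X₁, …, X_e)` of the fibre (lying over
  for the finite map `Λ → B ⧸ 2B`); `B` is (weakly) quasi-finite over `Λ` at `𝔫` because
  `B ⧸ 𝔪B` is module-finite over `Λ`;
* Zariski's Main Theorem (Mathlib
  `Algebra.QuasiFiniteAt.exists_fg_and_exists_notMem_and_awayMap_bijective`): a module-finite
  `Λ`-subalgebra `S' ⊆ B` and `r ∈ S' ∖ 𝔫` with `S'[1/r] = B[1/r]`;
* going down for the integral extension `Λ ⊆ S'` of domains (`Λ` is integrally closed): a prime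
  `𝔔' ⊆ 𝔫 ∩ S'` of `S'` over `𝔭 = (X₁, …, X_e)`; then `D = S' ⧸ 𝔔'` is a domain of
  characteristic `0`, integral over `Λ ⧸ 𝔭 = ℤ` and spanned over `ℤ` by finitely many elements;
  it embeds into `ℂ` (`IsAlgClosed.lift`), its image generates a number field `K'` and lands in
  `𝓞 K'`, and a prime `P'` of `𝓞 K'` over the image of `𝔫` exists (lying over); `r` becomes a
  unit in `𝓞_(P')`, so `B → B[1/r] = S'[1/r] → 𝓞_(P')`.

Honest framing: folklore commutative algebra (EGA IV-style "integral points specialising into a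
given fibre"), recorded as a helper; nothing here is progress on VP ≠ VNP.
-/

noncomputable section

open MvPolynomial

-- the summit and the problem share the name `ValiantsHypothesis` (D-0017 single-conjunct layout)
set_option linter.dupNamespace false

namespace Summit.ValiantsHypothesis.ValiantsHypothesis.Theorems.TwoAdicLadder.TwoIntegralNormalisation

section Main

variable {B : Type} [CommRing B] [IsDomain B] [CharZero B] [Algebra.FiniteType ℤ B]

set_option maxHeartbeats 400000 in
/-- **Arithmetic specialisation into a `2`-adically integral number ring.** A finitely generated
`ℤ`-algebra `B` which is a domain of characteristic `0` in which `2` is not a unit admits a ring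
homomorphism `B → 𝓞_(P')` to the local ring at some prime `P' ∋ 2` of the ring of integers of some
number field `K'`. (An integral affine `ℤ`-scheme of finite type with non-empty fibre at `2` has a
`2`-integral algebraic point specialising into that fibre.) Proof: Noether coordinates of the fibre
(`exists_noether_lift`), a prime `𝔫 ∋ 2` over the origin of the fibre, Zariski's Main Theorem at
`𝔫` (Mathlib), going down along the module-finite `ℤ[X] ⊆ S'`, and an embedding of the resulting
order into `ℂ`. [folklore; EGA IV-style] -/
theorem exists_ringHom_localizationAtPrime (h2 : ¬ IsUnit (2 : B)) :
    ∃ (K : Type) (_ : Field K) (_ : NumberField K) (P : Ideal (NumberField.RingOfIntegers K))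
      (_ : P.IsPrime), (2 : NumberField.RingOfIntegers K) ∈ P ∧
      Nonempty (B →+* Localization.AtPrime P) := by
  classical
  obtain ⟨e, t, hmod, hfin⟩ := exists_noether_lift h2
  have hinj : Function.Injective (aeval t : MvPolynomial (Fin e) ℤ →ₐ[ℤ] B) :=
    injective_aeval_of_injective_mod_two t eq_zero_of_two_mul_eq_zero hmod
  set I : Ideal B := Ideal.span {(2 : B)} with hI
  -- `B` as an algebra over `Λ = ℤ[X₁,…,X_e]`
  letI algΛB : Algebra (MvPolynomial (Fin e) ℤ) B :=
    (aeval t : MvPolynomial (Fin e) ℤ →ₐ[ℤ] B).toRingHom.toAlgebra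
  have halg : ∀ l, algebraMap (MvPolynomial (Fin e) ℤ) B l = aeval t l := fun _ => rfl
  haveI : IsScalarTower ℤ (MvPolynomial (Fin e) ℤ) B :=
    IsScalarTower.of_algebraMap_eq fun n => by simp [halg]
  haveI : Algebra.FiniteType (MvPolynomial (Fin e) ℤ) B :=
    Algebra.FiniteType.of_restrictScalars_finiteType ℤ _ B
  have halgI : ∀ l, algebraMap (MvPolynomial (Fin e) ℤ) (B ⧸ I) l =
      Ideal.Quotient.mk I (aeval t l) := fun _ => rfl
  haveI hfinI : Module.Finite (MvPolynomial (Fin e) ℤ) (B ⧸ I) := by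
    have heq : algebraMap (MvPolynomial (Fin e) ℤ) (B ⧸ I) =
        (Ideal.Quotient.mk I).comp (aeval t : MvPolynomial (Fin e) ℤ →ₐ[ℤ] B).toRingHom :=
      RingHom.ext fun l => halgI l
    have hf := hfin
    rw [← heq] at hf
    exact RingHom.finite_algebraMap.mp hf
  -- the origin `𝔪 = (2, X₁, …, X_e)` of the fibre, a maximal ideal of `Λ`
  let π₀ : MvPolynomial (Fin e) ℤ →ₐ[ℤ] ZMod 2 := aeval 0
  have hπ₀ : Function.Surjective π₀ := by
    intro x
    obtain ⟨n, rfl⟩ := ZMod.intCast_surjective x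
    exact ⟨C n, by simp [π₀]⟩
  have hπ₀map : ∀ l, π₀ l = eval 0 (MvPolynomial.map (Int.castRingHom (ZMod 2)) l) := by
    intro l
    rw [MvPolynomial.eval_map, MvPolynomial.aeval_def]
    rfl
  let 𝔪 : Ideal (MvPolynomial (Fin e) ℤ) := RingHom.ker π₀.toRingHom
  haveI h𝔪max : 𝔪.IsMaximal := RingHom.ker_isMaximal_of_surjective π₀.toRingHom hπ₀
  -- a prime `𝔫 ∋ 2` of `B` over `𝔪` (lying over for the finite map `Λ → B ⧸ 2B`)
  haveI : Algebra.IsIntegral (MvPolynomial (Fin e) ℤ) (B ⧸ I) := Algebra.IsIntegral.of_finite _ _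
  have hker : RingHom.ker (algebraMap (MvPolynomial (Fin e) ℤ) (B ⧸ I)) ≤ 𝔪 := by
    intro l hl
    rw [RingHom.mem_ker, halgI, Ideal.Quotient.eq_zero_iff_mem] at hl
    change π₀.toRingHom l = 0
    rw [AlgHom.toRingHom_eq_coe, RingHom.coe_coe, hπ₀map, hmod l hl, map_zero]
  obtain ⟨Q, hQmax, hQ⟩ := Ideal.exists_ideal_over_maximal_of_isIntegral (S := B ⧸ I) 𝔪 hker
  let 𝔫 : Ideal B := Q.comap (Ideal.Quotient.mk I)
  haveI h𝔫 : 𝔫.IsPrime := Ideal.comap_isPrime _ _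
  have h2𝔫 : (2 : B) ∈ 𝔫 := by
    change Ideal.Quotient.mk I 2 ∈ Q
    have h0 : Ideal.Quotient.mk I (2 : B) = 0 :=
      Ideal.Quotient.eq_zero_iff_mem.2 (hI ▸ Ideal.subset_span rfl)
    rw [h0]
    exact Q.zero_mem
  have hunder : 𝔫.under (MvPolynomial (Fin e) ℤ) = 𝔪 := by
    rw [← hQ, Ideal.under, Ideal.comap_comap]
    rfl
  have hC2 : (C 2 : MvPolynomial (Fin e) ℤ) ∈ 𝔫.under (MvPolynomial (Fin e) ℤ) := by
    rw [Ideal.under, Ideal.mem_comap, halg, MvPolynomial.algHom_C, algebraMap_int_eq, map_ofNat]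
    exact h2𝔫
  -- `B` is (weakly) quasi-finite over `Λ` at `𝔫`: `B ⧸ 𝔪B` is module-finite over `Λ`
  haveI : Algebra.WeaklyQuasiFiniteAt (MvPolynomial (Fin e) ℤ) 𝔫 := by
    set J : Ideal B := (𝔫.under (MvPolynomial (Fin e) ℤ)).map
      (algebraMap (MvPolynomial (Fin e) ℤ) B) with hJ
    have hIJ : I ≤ J := by
      rw [hI, Ideal.span_le, Set.singleton_subset_iff]
      have := Ideal.mem_map_of_mem (algebraMap (MvPolynomial (Fin e) ℤ) B) hC2
      rwa [halg, MvPolynomial.algHom_C, algebraMap_int_eq, map_ofNat] at this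
    haveI : Module.Finite (MvPolynomial (Fin e) ℤ) (B ⧸ J) := by
      refine Module.Finite.of_surjective
        (Ideal.Quotient.factorₐ (MvPolynomial (Fin e) ℤ) hIJ).toLinearMap fun x => ?_
      obtain ⟨b, rfl⟩ := Ideal.Quotient.mk_surjective x
      exact ⟨Ideal.Quotient.mk I b, rfl⟩
    change Algebra.QuasiFinite (MvPolynomial (Fin e) ℤ)
      (Localization.AtPrime (𝔫.map (Ideal.Quotient.mk J)))
    infer_instance
  -- Zariski's Main Theorem at `𝔫`
  obtain ⟨S', hS'fg, r, hr𝔫, hbij⟩ :=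
    Algebra.QuasiFiniteAt.exists_fg_and_exists_notMem_and_awayMap_bijective
      (R := MvPolynomial (Fin e) ℤ) 𝔫
  haveI : Module.Finite (MvPolynomial (Fin e) ℤ) S' := ⟨(Submodule.fg_top _).mpr hS'fg⟩
  haveI : Algebra.IsIntegral (MvPolynomial (Fin e) ℤ) S' := Algebra.IsIntegral.of_finite _ _
  haveI : FaithfulSMul (MvPolynomial (Fin e) ℤ) S' := by
    rw [faithfulSMul_iff_algebraMap_injective]
    intro a b hab
    apply hinj
    have := congrArg (S'.val : S' →ₐ[MvPolynomial (Fin e) ℤ] B) hab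
    simpa [halg] using this
  -- going down along `Λ ⊆ S'`: a prime `𝔔' ⊆ 𝔫 ∩ S'` over `𝔭 = (X₁, …, X_e)`
  let ρ : MvPolynomial (Fin e) ℤ →ₐ[ℤ] ℤ := aeval 0
  let 𝔭 : Ideal (MvPolynomial (Fin e) ℤ) := RingHom.ker ρ.toRingHom
  haveI : 𝔭.IsPrime := RingHom.ker_isPrime _
  have hρπ : ∀ l, (Int.castRingHom (ZMod 2)) (ρ l) = π₀ l := by
    intro l
    have : (Int.castRingHom (ZMod 2)).comp ρ.toRingHom = π₀.toRingHom :=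
      MvPolynomial.ringHom_ext (fun n => by simp [ρ, π₀]) (fun i => by simp [ρ, π₀])
    exact RingHom.congr_fun this l
  have h𝔭𝔪 : 𝔭 ≤ 𝔪 := by
    intro l hl
    change ρ.toRingHom l = 0 at hl
    change π₀.toRingHom l = 0
    rw [AlgHom.toRingHom_eq_coe, RingHom.coe_coe] at hl ⊢
    rw [← hρπ, hl, map_zero]
  let 𝔫' : Ideal S' := 𝔫.comap (S'.val : S' →ₐ[MvPolynomial (Fin e) ℤ] B)
  haveI : 𝔫'.IsPrime := Ideal.comap_isPrime _ _
  haveI : 𝔫'.LiesOver 𝔪 := ⟨by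
    rw [← hunder]
    ext l
    exact Iff.rfl⟩
  obtain ⟨𝔔', h𝔔'le, h𝔔', h𝔔'over⟩ :=
    Ideal.exists_ideal_le_liesOver_of_le (p := 𝔭) (q := 𝔪) 𝔫' h𝔭𝔪
  haveI := h𝔔'
  -- the order `D = S' ⧸ 𝔔'`: a domain of characteristic `0`, integral over `ℤ`
  have hD𝔭 : ∀ l ∈ 𝔭, algebraMap (MvPolynomial (Fin e) ℤ) (S' ⧸ 𝔔') l = 0 := by
    intro l hl
    rw [IsScalarTower.algebraMap_apply (MvPolynomial (Fin e) ℤ) S' (S' ⧸ 𝔔'),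
      Ideal.Quotient.algebraMap_eq, Ideal.Quotient.eq_zero_iff_mem]
    have : l ∈ 𝔔'.under (MvPolynomial (Fin e) ℤ) := by rw [← h𝔔'over.over]; exact hl
    exact this
  have hfactor : ∀ l, algebraMap (MvPolynomial (Fin e) ℤ) (S' ⧸ 𝔔') l =
      algebraMap ℤ (S' ⧸ 𝔔') (ρ l) := by
    intro l
    have hl : l - C (ρ l) ∈ 𝔭 := by
      change ρ.toRingHom (l - C (ρ l)) = 0
      simp [ρ]
    have := hD𝔭 _ hl
    rw [map_sub, sub_eq_zero] at this
    rw [this, eq_intCast C (ρ l), map_intCast, eq_intCast]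
  haveI : CharZero (S' ⧸ 𝔔') := by
    refine charZero_of_inj_zero fun n hn => ?_
    have h1 : algebraMap (MvPolynomial (Fin e) ℤ) (S' ⧸ 𝔔') (C (n : ℤ)) = 0 := by
      rw [hfactor]; simpa [ρ] using hn
    rw [IsScalarTower.algebraMap_apply (MvPolynomial (Fin e) ℤ) S' (S' ⧸ 𝔔'),
      Ideal.Quotient.algebraMap_eq, Ideal.Quotient.eq_zero_iff_mem] at h1
    have h2 : (C (n : ℤ) : MvPolynomial (Fin e) ℤ) ∈ 𝔭 := by
      rw [h𝔔'over.over]; exact h1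
    change ρ.toRingHom (C (n : ℤ)) = 0 at h2
    simpa [ρ] using h2
  haveI : Algebra.IsIntegral ℤ (S' ⧸ 𝔔') := by
    refine ⟨fun x => ?_⟩
    obtain ⟨q, hq, hqx⟩ := (Algebra.IsIntegral.isIntegral (R := MvPolynomial (Fin e) ℤ) x)
    refine ⟨q.map ρ.toRingHom, hq.map _, ?_⟩
    rw [Polynomial.eval₂_map]
    have : (algebraMap ℤ (S' ⧸ 𝔔')).comp ρ.toRingHom =
        algebraMap (MvPolynomial (Fin e) ℤ) (S' ⧸ 𝔔') :=
      RingHom.ext fun l => (hfactor l).symm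
    rw [this]
    exact hqx
  -- embed `D` into `ℂ`
  haveI : IsAddTorsionFree (S' ⧸ 𝔔') := IsAddTorsionFree.of_isDomain_charZero
  have hTF : Module.IsTorsionFree ℤ (S' ⧸ 𝔔') :=
    Module.isTorsionFree_int_iff_isAddTorsionFree.mpr inferInstance
  have hTFC : Module.IsTorsionFree ℤ ℂ :=
    Module.isTorsionFree_int_iff_isAddTorsionFree.mpr inferInstance
  haveI : Algebra.IsAlgebraic ℤ (S' ⧸ 𝔔') := Algebra.IsIntegral.isAlgebraic
  let emb : (S' ⧸ 𝔔') →ₐ[ℤ] ℂ :=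
    @IsAlgClosed.lift ℂ _ _ ℤ _ _ (S' ⧸ 𝔔') _ _ _ _ hTF hTFC inferInstance
  have hemb : Function.Injective emb := by
    rw [RingHom.injective_iff_ker_eq_bot]
    refine Ideal.eq_bot_of_comap_eq_bot (R := ℤ) (eq_bot_iff.2 fun n hn => ?_)
    have h1 : emb (algebraMap ℤ (S' ⧸ 𝔔') n) = 0 := RingHom.mem_ker.1 (Ideal.mem_comap.1 hn)
    rw [AlgHom.commutes, eq_intCast, Int.cast_eq_zero] at h1
    rw [h1]
    exact Ideal.zero_mem _
  -- `D` is spanned over `ℤ` by the images of the `Λ`-module generators of `S'`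
  obtain ⟨G, hG⟩ := (Submodule.fg_top _).mpr hS'fg
  let mkD : S' →+* S' ⧸ 𝔔' := Ideal.Quotient.mk 𝔔'
  have hmkD : ∀ l, mkD (algebraMap (MvPolynomial (Fin e) ℤ) S' l) = ((ρ l : ℤ) : S' ⧸ 𝔔') := by
    intro l
    rw [← eq_intCast (algebraMap ℤ (S' ⧸ 𝔔')), ← hfactor]
    rfl
  have hspan : ∀ d : S' ⧸ 𝔔',
      d ∈ Submodule.span ℤ ((fun g : S' => mkD g) '' (G : Set S')) := by
    intro d
    obtain ⟨x, rfl⟩ := Ideal.Quotient.mk_surjective d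
    have hx : x ∈ Submodule.span (MvPolynomial (Fin e) ℤ) (G : Set S') := by
      rw [hG]; exact Submodule.mem_top
    refine Submodule.span_induction (p := fun x _ => mkD x ∈ Submodule.span ℤ _)
      ?_ ?_ ?_ ?_ hx
    · intro g hg
      exact Submodule.subset_span ⟨g, hg, rfl⟩
    · rw [map_zero]; exact Submodule.zero_mem _
    · intro x y _ _ hx hy
      rw [map_add]; exact Submodule.add_mem _ hx hy
    · intro l x _ hx
      rw [Algebra.smul_def, map_mul, hmkD, ← zsmul_eq_mul]
      exact Submodule.smul_mem _ _ hx
  -- the number field `K'` generated by the image of `D` in `ℂ`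
  let gens : Set ℂ := (fun g : S' => emb (mkD g)) '' (G : Set S')
  haveI : Finite gens := (G.finite_toSet.image _).to_subtype
  let K' : IntermediateField ℚ ℂ := IntermediateField.adjoin ℚ gens
  haveI : FiniteDimensional ℚ K' := IntermediateField.finiteDimensional_adjoin fun x hx => by
    obtain ⟨g, -, rfl⟩ := hx
    exact ((Algebra.IsIntegral.isIntegral (R := ℤ) (mkD g)).map emb).tower_top
  haveI : NumberField K' := NumberField.mk
  have hmemK : ∀ d, emb d ∈ K' := by
    intro d
    refine Submodule.span_induction (p := fun d _ => emb d ∈ K') ?_ ?_ ?_ ?_ (hspan d)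
    · rintro _ ⟨g, hg, rfl⟩
      exact IntermediateField.subset_adjoin _ _ ⟨g, hg, rfl⟩
    · rw [map_zero]; exact zero_mem _
    · intro x y _ _ hx hy
      rw [map_add]; exact add_mem hx hy
    · intro n x _ hx
      rw [map_zsmul]; exact zsmul_mem hx n
  let ψK : (S' ⧸ 𝔔') →+* K' := (emb : (S' ⧸ 𝔔') →+* ℂ).codRestrict K' hmemK
  have hψK : Function.Injective ψK := fun x y hxy => hemb (congrArg Subtype.val hxy)
  -- `D → 𝓞 K'`
  letI algDK : Algebra (S' ⧸ 𝔔') K' := ψK.toAlgebra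
  have hIST : @IsScalarTower ℤ (S' ⧸ 𝔔') K' Algebra.toSMul Algebra.toSMul Algebra.toSMul :=
    IsScalarTower.of_algebraMap_eq fun n => by
      apply Subtype.ext
      change ((n : K') : ℂ) = emb (algebraMap ℤ (S' ⧸ 𝔔') n)
      rw [AlgHom.commutes]
      simp
  let ψO : (S' ⧸ 𝔔') →ₐ[ℤ] NumberField.RingOfIntegers K' :=
    @IsIntegralClosure.lift ℤ (NumberField.RingOfIntegers K') K' _ _ _ _ _ _ (S' ⧸ 𝔔') _ _ _
      hIST _ _ inferInstance
  have hψO : ∀ d, algebraMap (NumberField.RingOfIntegers K') K' (ψO d) = ψK d :=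
    fun d => @IsIntegralClosure.algebraMap_lift ℤ (NumberField.RingOfIntegers K') K' _ _ _ _ _ _
      (S' ⧸ 𝔔') _ _ _ hIST _ _ inferInstance d
  have hψOinj : Function.Injective ψO := by
    intro x y hxy
    apply hψK
    rw [← hψO, ← hψO, hxy]
  letI algDO : Algebra (S' ⧸ 𝔔') (NumberField.RingOfIntegers K') := ψO.toRingHom.toAlgebra
  have halgDO : ∀ d, algebraMap (S' ⧸ 𝔔') (NumberField.RingOfIntegers K') d = ψO d := fun _ => rfl
  have hIST' : @IsScalarTower ℤ (S' ⧸ 𝔔') (NumberField.RingOfIntegers K')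
      Algebra.toSMul Algebra.toSMul Algebra.toSMul :=
    IsScalarTower.of_algebraMap_eq fun n => by rw [halgDO, AlgHom.commutes]
  haveI : Algebra.IsIntegral (S' ⧸ 𝔔') (NumberField.RingOfIntegers K') :=
    @Algebra.IsIntegral.tower_top ℤ (S' ⧸ 𝔔') (NumberField.RingOfIntegers K') _ _ _ _ _ _
      hIST' inferInstance
  -- the prime `𝔫D` of `D` below which we localise, and a prime `P'` of `𝓞 K'` over it
  let 𝔫D : Ideal (S' ⧸ 𝔔') := 𝔫'.map mkD
  have hker𝔫 : RingHom.ker mkD ≤ 𝔫' := by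
    rw [Ideal.mk_ker]; exact h𝔔'le
  haveI : 𝔫D.IsPrime := Ideal.map_isPrime_of_surjective Ideal.Quotient.mk_surjective hker𝔫
  have hcomap𝔫D : 𝔫D.comap mkD = 𝔫' := by
    rw [Ideal.comap_map_of_surjective _ Ideal.Quotient.mk_surjective, sup_eq_left]
    rwa [← RingHom.ker_eq_comap_bot]
  obtain ⟨P', -, hP', hP'comap⟩ :=
    Ideal.exists_ideal_over_prime_of_isIntegral (S := NumberField.RingOfIntegers K') 𝔫D ⊥
      (by
        rw [← RingHom.ker_eq_comap_bot,
          (RingHom.injective_iff_ker_eq_bot (algebraMap (S' ⧸ 𝔔') _)).1 fun x y h => hψOinj h]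
        exact bot_le)
  have hmemP' : ∀ d, ψO d ∈ P' ↔ d ∈ 𝔫D := fun d => by
    rw [← hP'comap, Ideal.mem_comap, halgDO]
  -- `2 ∈ P'`
  have h2𝔫' : (2 : S') ∈ 𝔫' := by
    change S'.val 2 ∈ 𝔫
    rw [map_ofNat]; exact h2𝔫
  have h2P' : (2 : NumberField.RingOfIntegers K') ∈ P' := by
    have : (2 : NumberField.RingOfIntegers K') = ψO (mkD 2) := by
      rw [map_ofNat mkD, map_ofNat ψO]
    rw [this, hmemP']
    exact Ideal.mem_map_of_mem _ h2𝔫'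
  -- `r` becomes a unit
  have hr𝔫' : r ∉ 𝔫' := hr𝔫
  have hrD : mkD r ∉ 𝔫D := fun h => hr𝔫' (by rw [← hcomap𝔫D]; exact h)
  have hrP' : ψO (mkD r) ∉ P' := fun h => hrD ((hmemP' _).1 h)
  let θ₀ : S' →+* Localization.AtPrime P' :=
    (algebraMap (NumberField.RingOfIntegers K') (Localization.AtPrime P')).comp
      (ψO.toRingHom.comp mkD)
  have hθ₀ : IsUnit (θ₀ r) :=
    IsLocalization.map_units (Localization.AtPrime P')
      ⟨ψO (mkD r), show ψO (mkD r) ∈ P'.primeCompl from hrP'⟩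
  let θ₁ : Localization.Away r →+* Localization.AtPrime P' := IsLocalization.Away.lift r hθ₀
  let ε : Localization.Away r ≃+* Localization.Away (S'.val.toRingHom r) :=
    RingEquiv.ofBijective _ hbij
  exact ⟨K', inferInstance, inferInstance, P', hP', h2P',
    ⟨θ₁.comp (ε.symm.toRingHom.comp (algebraMap B (Localization.Away (S'.val.toRingHom r))))⟩⟩

end Main

end Summit.ValiantsHypothesis.ValiantsHypothesis.Theorems.TwoAdicLadder.TwoIntegralNormalisation

end
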